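import Literature.Analysis.FluidPDE.Tao2016AveragedNS.SplitCascadeRescaledExit
import Literature.Analysis.FluidPDE.TaoCascadeSecondBootstrap
import Mathlib.MeasureTheory.Integral.IntervalIntegral.ContDiff
import HarnessLib

/-!
# The split Prop. 6.5, Cor. 6.14: the second bootstrap time (port of `TaoCascadeSecondBootstrap`)

T. Tao, *Finite time blowup for an averaged three-dimensional Navier–Stokes equation*,
arXiv:1402.0290v3, §6.6 Cor. 6.14.
HONEST FRAMING: statements about the SPLIT cascade model system; nothing here proves the split
Prop. 6.5 and nothing here concerns the true Navier–Stokes equations.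

Split counterpart of `TaoCascadeSecondBootstrap.lean`: the second bootstrap time `T₂ ≤ T₁` up to which
`∫₀^t ã₁² ≤ K^{-1/4}`, with the exits of Cor. 6.11; the `T1`-version carries the extra hypotheses of
the split exit trichotomy (`SplitCascadeRescaledExit.lean`): the `a`-asymmetry profile bound
`η(0) ≤ 10⁻³` and a bound `|Z̃_{d,1}| ≤ ζ`, `ζ² ≤ ¼K⁻²⁰` on `[0, T₁]`. Proofs otherwise the tree's.

## References

* T. Tao, arXiv:1402.0290v3, §6.6 Cor. 6.14. [`Tao2016AveragedNS`]
-/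

noncomputable section

open Set MeasureTheory intervalIntegral Filter Topology

namespace Literature.Analysis.FluidPDE

namespace Tao2016AveragedNS

open TaoCascade

open Literature.Analysis.ODE

section SecondBootstrap

variable {γ ε₀ K ε C₁ C₂ C₃ : ℝ} {n₀ N : ℤ} {ηp : ℤ → ℝ} {βp : ℕ → ℝ} {τ : ℤ → ℝ} {Xr : Fin 4 → ℤ → ℝ → ℝ} {W : Fin 3 → ℤ → ℝ → ℝ} {Er : ℤ → ℝ → ℝ}

/-- The primitive `t ↦ ∫₀ᵗ a₁²` is continuous on `[0, T]` ("using continuity").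
[cite: Tao2016AveragedNS, §6.6, definition of T₂] -/
theorem RescaledSplitHypotheses.continuousOn_integral_a_one_sq
    (h : RescaledSplitHypotheses γ ε₀ K ε C₁ C₂ C₃ n₀ N ηp βp τ Xr W Er) (hN : n₀ ≤ N) {T : ℝ} (hT : 0 ≤ T) :
    ContinuousOn (fun t => ∫ s in (0 : ℝ)..t, Xr 0 1 s ^ 2) (Icc 0 T) := by
  have hcont : ContinuousOn (fun s => Xr 0 1 s ^ 2) (Icc 0 T) :=
    (h.continuousOn_X 0 1 (h.tau_init_le hN)).pow 2
  have hint : IntegrableOn (fun s => Xr 0 1 s ^ 2) (uIcc 0 T) volume := by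
    rw [uIcc_of_le hT]
    exact hcont.integrableOn_Icc
  have := intervalIntegral.continuousOn_primitive_interval (μ := volume) hint
  rwa [uIcc_of_le hT] at this

/-- **Cor. 6.14 (exit trichotomy, again), proved**: let `T₁ ∈ [0, 100]` be a time at which the
trichotomy of Cor. 6.11 holds, and assume the forwards-exit exclusion of Prop. 6.13, (6.119), in the
form "`|d₁(T)| < ½ K⁻¹⁰` whenever `0 ≤ T ≤ T₁` and `∫₀ᵀ a₁² ≤ K^{-1/4}`". Then the largest time
`T₂ ∈ [0, T₁]` with `∫₀^{T₂} a₁² ≤ K^{-1/4}` satisfies (6.126) ∨ (6.127) ∨ (6.128), and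
`∫₀ᵗ a₁² ≤ K^{-1/4}` for all `t ∈ [0, T₂]`.
[cite: Tao2016AveragedNS, §6.6 Cor. 6.14] -/
theorem RescaledSplitHypotheses.exists_second_bootstrap_time
    (h : RescaledSplitHypotheses γ ε₀ K ε C₁ C₂ C₃ n₀ N ηp βp τ Xr W Er) (hN : n₀ ≤ N) (hK : 0 < K) {T₁ : ℝ}
    (hT₁ : T₁ ∈ Icc (0 : ℝ) 100)
    (hexit : Er (-1) T₁ = (K ^ 10)⁻¹ * (1 + ε₀) ^ ((2 : ℝ) / 10) ∨
      |Xr 3 1 T₁| = 1 / 2 * (K ^ 10)⁻¹ ∨ T₁ = 100)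
    (h13d : ∀ T ∈ Icc 0 T₁, (∫ t in (0 : ℝ)..T, Xr 0 1 t ^ 2) ≤ K ^ (-(1 : ℝ) / 4) →
      |Xr 3 1 T| < 1 / 2 * (K ^ 10)⁻¹) :
    ∃ T₂ ∈ Icc 0 T₁, (∀ t ∈ Icc 0 T₂, (∫ s in (0 : ℝ)..t, Xr 0 1 s ^ 2) ≤ K ^ (-(1 : ℝ) / 4)) ∧
      (Er (-1) T₂ = (K ^ 10)⁻¹ * (1 + ε₀) ^ ((2 : ℝ) / 10) ∨
        (∫ t in (0 : ℝ)..T₂, Xr 0 1 t ^ 2) = K ^ (-(1 : ℝ) / 4) ∨ T₂ = 100) := by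
  set P : ℝ → Prop := fun t => (∫ s in (0 : ℝ)..t, Xr 0 1 s ^ 2) ≤ K ^ (-(1 : ℝ) / 4) with hP
  set I : ℝ → ℝ := fun t => ∫ s in (0 : ℝ)..t, Xr 0 1 s ^ 2 with hI
  have h0T : (0 : ℝ) ≤ T₁ := hT₁.1
  have hP0 : P 0 := by
    show (∫ s in (0 : ℝ)..0, Xr 0 1 s ^ 2) ≤ K ^ (-(1 : ℝ) / 4)
    rw [intervalIntegral.integral_same]
    positivity
  have hIc : ContinuousOn I (Icc 0 T₁) := h.continuousOn_integral_a_one_sq hN h0T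
  have hclosed : ∀ t ∈ Ioc (0 : ℝ) T₁, (∀ s ∈ Ico 0 t, P s) → P t := fun t ht hs =>
    le_of_Ico_of_continuousOn (F := I) ht.1 (hIc.mono (Icc_subset_Icc le_rfl ht.2)) hs
  set T₂ : ℝ := maximalTimeP P 0 T₁ with hT₂
  have hmem : T₂ ∈ Icc 0 T₁ := maximalTimeP_mem h0T hP0
  have hspec : ∀ t ∈ Icc 0 T₂, P t := fun t ht => maximalTimeP_spec h0T hP0 hclosed ht
  refine ⟨T₂, hmem, hspec, ?_⟩
  rcases maximalTimeP_exit h0T hP0 with heq | hnot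
  · -- `T₂ = T₁`: Cor. 6.11 at `T₁`, the forwards exit (6.102) being excluded by Prop. 6.13
    have heq' : T₂ = T₁ := heq
    rcases hexit with h1 | h2 | h3
    · left; rw [heq']; exact h1
    · exfalso
      have hd := h13d T₁ ⟨h0T, le_rfl⟩ (heq' ▸ hspec T₂ ⟨hmem.1, le_rfl⟩)
      rw [h2] at hd
      exact lt_irrefl _ hd
    · right; right; rw [heq']; exact h3
  · -- `T₂ < T₁` (exit principle): `∫₀^{T₂} a₁² = K^{-1/4}` by continuity
    right; left
    by_contra hne
    have hlt : I T₂ < K ^ (-(1 : ℝ) / 4) := lt_of_le_of_ne (hspec T₂ ⟨hmem.1, le_rfl⟩) hne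
    have hcw : ContinuousWithinAt I (Icc 0 T₁) T₂ := hIc.continuousWithinAt hmem
    exact hnot ((hcw.eventually_lt_const hlt).mono fun t ht => ht.le)

/-- **Cor. 6.14 for the maximal time `T₁` of §6.5**, under the largeness hypotheses of Cor. 6.11
(`exit_trichotomy`) and the forwards-exit exclusion of Prop. 6.13 below `T₁`: there is
`T₂ ∈ [0, T₁]` with `∫₀ᵗ a₁² ≤ K^{-1/4}` on `[0, T₂]`, `GoodAt` on `[0, T₂]`, and
(6.126) ∨ (6.127) ∨ (6.128) at `T₂`. [cite: Tao2016AveragedNS, §6.6 Cor. 6.14] -/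
theorem RescaledSplitHypotheses.exists_second_bootstrap_time_T1
    (h : RescaledSplitHypotheses γ ε₀ K ε C₁ C₂ C₃ n₀ N ηp βp τ Xr W Er) (hε₀ : 0 < ε₀) (hε₀1 : ε₀ < 1)
    (hγ1 : γ ≤ 1 / 10 ^ 5) (hK : 0 < K) (hKε : 10 ^ 8 ≤ ε₀ * K ^ 4) (hε : 0 < ε) (hε1 : ε ≤ 1)
    (hC₂ : 0 ≤ C₂) (hC₃ : 0 ≤ C₃) (hN : n₀ ≤ N)
    (hn : C₂ * (1 + ε₀) ^ (-(n₀ : ℝ) / 2) * cumEnergyConst ε₀ C₃ ≤ 1 / 100)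
    (hη0 : ηp 0 ≤ 1 / 10 ^ 3) {ζ : ℝ} (hζ : ∀ t ∈ Icc 0 (T1 ε₀ K Xr Er), |W 2 1 t| ≤ ζ)
    (hζK : ζ ^ 2 ≤ 1 / 4 * (K ^ 20)⁻¹)
    (h13d : ∀ T ∈ Icc 0 (T1 ε₀ K Xr Er), (∫ t in (0 : ℝ)..T, Xr 0 1 t ^ 2) ≤ K ^ (-(1 : ℝ) / 4) →
      |Xr 3 1 T| < 1 / 2 * (K ^ 10)⁻¹) :
    ∃ T₂ ∈ Icc 0 (T1 ε₀ K Xr Er),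
      (∀ t ∈ Icc 0 T₂, (∫ s in (0 : ℝ)..t, Xr 0 1 s ^ 2) ≤ K ^ (-(1 : ℝ) / 4)) ∧
        (∀ t ∈ Icc 0 T₂, GoodAt ε₀ K Xr Er t) ∧
          (Er (-1) T₂ = (K ^ 10)⁻¹ * (1 + ε₀) ^ ((2 : ℝ) / 10) ∨
            (∫ t in (0 : ℝ)..T₂, Xr 0 1 t ^ 2) = K ^ (-(1 : ℝ) / 4) ∨ T₂ = 100) := by
  have hK2 : (2 : ℝ) ≤ K := by linarith [hundred_le_of_regime hε₀1 hK hKε]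
  have g0 := h.goodAt_zero hε₀ hε₀1 hγ1 hK2 hε hε1 hC₂ hC₃ hN hn hη0
  have hT := T1_mem g0
  have hexit := h.exit_trichotomy hε₀ hε₀1 hγ1 hK hKε hε hε1 hC₂ hC₃ hN hn hη0 hζ hζK
  obtain ⟨T₂, hmem, hint, hex⟩ := h.exists_second_bootstrap_time hN hK hT hexit h13d
  exact ⟨T₂, hmem, hint, fun t ht => h.goodAt_of_mem_T1 hN g0 ⟨ht.1, ht.2.trans hmem.2⟩, hex⟩

end SecondBootstrap

end Tao2016AveragedNS

end Literature.Analysis.FluidPDE
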